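import Mathlib
import HarnessLib
import HarnessLib.Audit
import Summits.Schanuel.Statement
import HarnessLib.Audit.Status.Attr

/-!
Route: ArithmeticalComplexity

DORMANT since 2026-08-23T00:34:59Z (reconciler: no traction for 5.8 d (last activity item-evidence-added at 2026-08-17T04:58:47Z); parked, not closed — `ledger route dormant route-Schanuel-ArithmeticalComplexity --off` to reactivate) — unstaffed, not closed; items shared with open routes are served there. `ledger route dormant <id> --off` reactivates.

# Route ArithmeticalComplexity — Schanuel lives on computable numbers and is an arithmetical ∀∃∀
sentence with two effective keys

It suffices to show X = COMPUTABLE SCHANUEL: Schanuel's inequality trdeg ℚ(z, e^z) ≥ n for every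
ℚ-linearly independent
tuple z of COMPUTABLE complex numbers (each zⱼ has a computable Gaussian-rational fast Cauchy name).
X ⟺ Schanuel because
every essential counterexample lies in Kirby's countable core E = ecl(∅) (tree theorem, inlined here
as `InCore`: coordinates of
non-degenerate zeros of square integer exponential-polynomial systems) and every point of E is
computable. Realises card
schanuel-arithmetical-complexity (spine; absorbs the retired arithmetical-hierarchy-calibration and
arithmetical-real-normal-forms):
along any uniformly computable enumeration of E the conjecture is a Π⁰₃ family of instances
(SchanuelPi03), Π⁰₂ under decidable
exponential-polynomial relations on E (crux Z = DecidableCoreRelations), and Π⁰₁ — counterexamples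
recursively enumerable, each
refutable by a finite certificate — under Z plus computably bounded ℤ-linear relations on E (crux M
= LinearRelationBound).
Lean: `∀ (n : ℕ) (z : Fin n → ℂ), (∀ j, ∃ g : ℕ → ℚ × ℚ, Computable g ∧ ∀ m : ℕ, ‖z j - (((g m).1 :
ℂ) + ((g m).2 : ℂ) * Complex.I)‖ ≤ 1 / 2 ^ m) → LinearIndependent ℚ z → (n : Cardinal) ≤
Algebra.trdeg ℚ ↥(IntermediateField.adjoin ℚ (Set.range z ∪ Set.range (Complex.exp ∘ z)))`

## Assembly
Pure logic (kernel-checked in Sketch.lean, axioms propext/Classical.choice/Quot.sound): by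
KirbyCoreReduction it suffices to treat
tuples z from the core; by CoreComputable each zⱼ is computable; ComputableSchanuel applies. The
cruxes Z and M do not enter the
assembly: they are the keys of the two descents (SchanuelPi02OfZeroTest, CounterexamplesRE) that say
what KIND of sentence X is.

Rationale: WHY THIS LINE. Mechanism: arithmetise the STANDARD instance set. Kirby2010EAEF (Thm 1.4, Prop 7.2;
tree `schanuelConjecture_iff_ecl_empty_holds`)
puts every essential counterexample in the countable core E; computable analysis (Turing1936,
Weihrauch2000; certified isolation of
non-degenerate zeros as in MacintyreWilkieKreiseliana1996 Thm 4.1 and JonesServi2011 §4, who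
enumerate the REAL Khovanskii points to
diagonalise a computable generic real) makes E a uniformly computable sequence, so "h·z ≠ 0" is Σ⁰₁,
linear independence Π⁰₂,
"td ≤ k" Σ⁰₂ and Schanuel Π⁰₃ outright — absolute (Shoenfield1967), with ¬SC a specified Σ⁰₃ search.
The two descents are tied
to named effectivity statements about E of independent standing: Z (Richardson1997's
zero-recognition for elementary numbers,
terminating under SC; Macintyre2016; the WSC circle of MacintyreWilkieKreiseliana1996 /
WilkieNATO1997 / arXiv:2603.08365 §13 is
its real shadow) and M (Masser1988LinearRelations / BakerWustholz1993 give it on the depth-1 sector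
of logarithms of algebraic
numbers). Imported areas: computability theory (arithmetical hierarchy, Post's theorem, r.e. sets)
and computable analysis; no
transcendence METHOD is proposed — the line fixes what kind of sentence SC is, what refuting it
formally consists of, and which
two effective Diophantine statements lower its complexity. Unlike the closed EclCore (Kirby's
reduction alone, now a Literature
theorem) the items here are new theorems about E (effective enumerability, calibration, descents),
all stated Mathlib-only with
the core inlined so that the route's import cone adds nothing to the Statement's; negatives index
empty at filing.

RANKED CRUXES. #0 ComputableSchanuel (target) — Schanuel's conjecture for tuples of computable
complex numbers (each coordinate has a computable ℚ × ℚ fast Cauchy name); X of the thesis. (why it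
might fail: It is Schanuel itself (⟺ via CoreComputable + KirbyCoreReduction): z = (1, πi) is
computable, so it already contains algebraic independence of e and π; false iff some ℚ-independent
tuple of exponential-algebraic numbers has td(z, e^z) < n.) [Kirby2010EAEF, Macintyre2016,
Waldschmidt2000, Turing1936]
#2 EffectiveCore (crux) — the core E (inlined ecl ∅: coordinates of non-degenerate zeros of square
systems F(v, e^v) = 0, F over ℤ) is the range of a UNIFORMLY computable sequence a : ℕ → ℂ (one
computable f : ℕ × ℕ → ℚ × ℚ with ‖a k − f(k,m)‖ ≤ 2⁻ᵐ). Card P1/DEF; the unproved fact every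
interpretation below rests on, hence ranked first. [difficulty: L] (why it might fail:
Mathematically safe (JonesServi2011 §4: the real case via MW96 Thm 4.1); the risk is formal:
surjectivity needs EVERY non-degenerate complex zero isolated by a certified rational ball
(quantitative inverse function theorem / Krawczyk) plus dovetailing over a merely r.e. set of
solvable systems.) [JonesServi2011, MacintyreWilkieKreiseliana1996, Richardson1997, Kirby2010EAEF,
Weihrauch2000]
#3 DecidableCoreRelations (crux) — (Z, the Π⁰₂ key) some uniformly computable enumeration a of the
core admits a DECISION procedure for exponential-polynomial relations: for index lists l and
list-coded P ∈ ℤ[X, Y], whether P(a(l), e^{a(l)}) = 0. Richardson's zero-recognition problem for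
exponential-algebraic constants; known to terminate under SC, open unconditionally. [deps:
EffectiveCore] [difficulty: open-problem] (why it might fail: Unconditionally open since Richardson:
every known procedure (Richardson1997, MW96/WSC, Macintyre2016) terminates only under SC;
undecidability of the constant problem is not excluded — and since SC ⇒ Z, a refutation ¬Z would
refute Schanuel outright.) [Richardson1997, Macintyre2016, MacintyreWilkieKreiseliana1996,
WilkieNATO1997, arXiv:2603.08365]
#4 LinearRelationBound (crux) — (M, the Π⁰₁ key) some uniformly computable enumeration a of the core
carries a COMPUTABLE height bound H(l) for ℤ-linear relations: a ℚ-dependent sub-tuple a(l) has a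
non-zero relation with coefficients ≤ H(l). With Z for the same a, ℚ-linear independence on E
becomes decidable and counterexamples to SC become r.e. (CounterexamplesRE). Depth-1 rung (logs of
algebraic numbers) = Masser / Baker–Wüstholz. [deps: EffectiveCore] [difficulty: open-problem] (why
it might fail: Open beyond depth 1: no height bound for ℤ-relations among coordinates of general
Khovanskii points in terms of the defining data is known; nested exponentials might make relation
heights outgrow every computable function (for SOME presentations halting-time padding does, hence
the ∃-form).) [Masser1988LinearRelations, BakerWustholz1993, Macintyre2016, Kirby2010EAEF]
#9 CoreComputable (support) — every point of the core E is a computable complex number (pointwise;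
isolated non-degenerate zero of an analytic map with integer data ⇒ computable by certified search
in a hard-coded isolating box). With KirbyCoreReduction it gives X ⟺ Schanuel. [difficulty: M]
[Weihrauch2000, Richardson1997, JonesServi2011]
#9 KirbyCoreReduction (support) — Schanuel ⟺ Schanuel for tuples from the inlined core. Bookkeeping
over the tree theorem
`Literature.NumberTheory.Transcendental.schanuelConjecture_iff_ecl_empty_holds` plus the
identification InCore = `ecl ∅` for ℂ (ℤ-polynomials via `aeval` vs coefficients in `Subring.closure
∅`; `expPDeriv` matches verbatim). Prove it LAST: its proof imports KirbyWeakSchanuelAx and widens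
the route cone. [difficulty: provable-now] [Kirby2010EAEF, Kirby2013FPEF]
#9 LinIndepPi02 (support) — along any uniformly computable sequence a : ℕ → ℂ, ℚ-linear independence
of the finite sub-tuples a(l) is Π⁰₂ uniformly in l (∀ relation ∃ precision witnessing apartness;
effective apartness as in the tree's KZ-periods barrier file). [difficulty: M] [Weihrauch2000,
Turing1936]
#9 SchanuelPi03 (support) — (headline, unconditional) along any uniformly computable sequence the
Schanuel instances form a Π⁰₃ family uniformly: LinIndep is Π⁰₂, "td(a(l), e^{a(l)}) ≤ k" is Σ⁰₂ (∀
n-subsets ∃ integer polynomial vanishing to every precision), so LinIndep → td ≥ n is Σ⁰₂ ∨ Π⁰₂ ⊆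
Π⁰₃. With EffectiveCore + KirbyCoreReduction this is "SC is a Π⁰₃ sentence". [difficulty: M]
[Shoenfield1967, Weihrauch2000, Kirby2010EAEF]
#9 SchanuelPi02OfZeroTest (support) — (Π⁰₂ descent) if exponential-polynomial relations along a are
decidable then LinIndep is Π⁰₁, "td < n" is Σ⁰₁, and the instance family is ∀ over an r.e. matrix
(Δ⁰₂ ⊆ Π⁰₂), uniformly. [difficulty: M] [Richardson1997, Shoenfield1967]
#9 CounterexamplesRE (support) — (Π⁰₁ descent) if along a relations are decidable (Z) and ℤ-linear
relations computably bounded (M) then linear independence is decidable, "td < n" is r.e., and the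
set of counterexample tuples is RECURSIVELY ENUMERABLE: Schanuel along a is Π⁰₁ — refutable, if
false, by one finite computation — and the negative-side search NotSchanuel has a complete
specification. [difficulty: M] [Masser1988LinearRelations, Richardson1997, Shoenfield1967]
#9 NotSchanuel (support) — negative side, now SPECIFIED: a counterexample is a ℚ-independent tuple
of the r.e. core with td < n; enumerate certified Khovanskii codes by complexity (EffectiveCore),
flag suspects by PSLQ, and note that a CERTIFICATE of a relation needs Z (exact vanishing is never
numerically certifiable) — under Z + M the search is complete (CounterexamplesRE). Expected:
evidence "no counterexample below complexity C", not a proof. [difficulty: open-problem]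
[Kirby2010EAEF, Richardson1997]

TWO-LAYER PLAN. EffectiveCore ⇐ CertifiedIsolation (a Krawczyk / MW96-Thm-4.1-type test: passing ⇒
unique non-degenerate zero in the ball, and
every non-degenerate zero passes on some rational ball) → DovetailedEnumeration (r.e. family of
certified codes ⇒ uniformly
computable surjection onto E) → EffectiveCore. DecidableCoreRelations ⇐ depth-1 rung
(Lindemann–Weierstrass sector + ℤ-linear
forms in logarithms: decidable by LW + Baker) → general core. LinearRelationBound ⇐ depth-1 rung
(Masser1988LinearRelations /
BakerWustholz1993 explicit bounds for logarithms of algebraic numbers) → general core. k ≤ 3 each,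
depth 1.

KILL CRITERIA. ¬DecidableCoreRelations proved (undecidability of exponential-polynomial relations on
E in every effective presentation): since
SC ⇒ Z (Richardson1997; cite fact requested), this REFUTES SCHANUEL — close every route, hand the
theorem to NotSchanuel.
¬LinearRelationBound: kills only the Π⁰₁ descent (pivot: SC stays "Π⁰₂ under Z"; restate M for the
canonical Khovanskii coding).
¬EffectiveCore or ¬CoreComputable: impossible unless `InCore` mis-states Kirby's ecl ∅ — repair the
inlined definition, not the line.
¬ComputableSchanuel = ¬Schanuel (closes the summit negatively). Schanuel proved elsewhere moots X
but NOT the calibration items.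

NOT DECOMPOSED YET. The identification InCore = `Literature.NumberTheory.Transcendental.ecl ∅`
(bookkeeping inside KirbyCoreReduction's proof; kept
out of the items to keep the cone Mathlib-only); the lemma "td ≤ k is Σ⁰₂ along a computable
sequence" (inside SchanuelPi03);
the canonical coding KhovCode with a DECIDABLE certificate (definition request below — the
presentation-free home of Z and M);
the absoluteness remark (SC is Π¹₁ as written, hence Shoenfield-absolute: meta-level, no Lean item);
the WSC bridge
(MacintyreWilkieKreiseliana1996 §5, arXiv:2603.08365 Conj. 13.4: WSC is an effective zero SEPARATION
on real Khovanskii points,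
i.e. Z for E ∩ ℝ-systems; SC ⇒ WSC ⟺ Th(ℝ_exp) decidable) — needs a coding of Th(ℝ_exp), not filed;
the kit enumeration of the
core to small complexity (card P6) — a refuter/kit job attached to NotSchanuel, not an item.

CHEAPEST FALSIFIER. A literature lookup: Macintyre2016 ("Turing meets Schanuel", APAL 167;
paywalled, acq-00511 open) very likely proves effective
enumerability of the exponential-algebraic numbers and Z under SC, and may state X ⟺ SC; if so
EffectiveCore / ComputableSchanuel
grade `known` (they survive as formalisation targets) and the delta shrinks to the explicit ladder +
M. Lean-side: a grounder
check that the inlined core equals `ecl ∅` (ℤ-coefficients via `aeval` = coefficients in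
`Subring.closure ∅`; Jacobian =
`expPDeriv`, compared verbatim) — I ran `lean check` on Sketch.lean (rc 0, all eleven Props
elaborate; assembly proved).

NUMBERS. Complexity ladder: Π⁰₃ unconditionally (SchanuelPi03); Π⁰₂ under Z; Π⁰₁ under Z + M; ¬SC is
Σ⁰₃ now, Σ⁰₁ at the bottom.
Known rungs: Z on the Lindemann–Weierstrass sector and for ℤ-linear forms in logarithms (Baker); M
for logarithms of algebraic
numbers (Masser1988LinearRelations; BakerWustholz1993 explicit constant); first open rung of Z:
quadratic relations in two
logarithms (card quadratic-logs-holonomy). WSC = computable zero separation q(n, H, g)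
(arXiv:2603.08365 Conj. 13.4). Items at open: 12.

DEFINITION REQUESTS. KhovCode (topic Literature/NumberTheory/Transcendental, for EffectiveCore):
certified Khovanskii codes c = (n, F over ℤ, Gaussian-
rational ball) with a DECIDABLE Krawczyk-type predicate `Cert c` and `point : {c // Cert c} → (Fin n
→ ℂ)` hitting exactly the
non-degenerate zeros — the canonical presentation in which Z and M become presentation-free. Cite
fact wanted (kill criterion):
"Schanuel ⇒ zero-recognition for exponential-algebraic (elementary) constants terminates"
(Richardson1997; Macintyre2016).

Novelty: Searches (2026-08-15): `lit search "Turing meets Schanuel" --source zbmath` (1: Macintyre2016,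
paywalled → acq-00511); `lit galaxy
search "Turing meets Schanuel" --star all` (1 irrelevant panama hit); `lit galaxy search
"exponential algebraic closure" --star all` (0);
`lit galaxy search "exponentially transcendental" --star all` (2: Pila2022 book; JonesServi2011
preprint pdf:-7187079370727089280, READ in
full: §4 computable generic real by enumerating real Khovanskii points via MW96 Thm 4.1); `lit
galaxy search "Schanuel's conjecture"
--star pdf` (10; Mariaule arXiv:1408.0900 p-adic decidability); `lit frontier Schanuel --since 2020`
(30 rows; row 16 arXiv:2603.08365
read pp.1-2, 66: WSC as computable zero separation, first-order side); `lit search --hybrid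
"decidability exponential constants Schanuel
zero test"` (8 irrelevant books); the three sibling cards and the refuter audit of the spine card
(Richardson 1992/1997, Chow 1999,
Chonev–Ouaknine–Worrell use SC as an oracle hypothesis, never classify SC); `ledger negatives
--problem Schanuel` (0).
Nearest prior art found: Macintyre2016 (doi:10.1016/j.apal.2015.10.003; computable Zilber fields,
SC-conditional decidability —
unread, flagged), Richardson1997 (zero test terminating under SC), JonesServi2011 §4 +
MacintyreWilkieKreiseliana1996 Thm 4.1
(effective enumeration of real Khovanskii points), Kirby2010EAEF Thm 1.4 (countable core, in tree).
Delta: the explicit, Lean-stated calibration — SC ⟺ Schanuel on computable tuples;  [refs: 10.1016/j.apal.2015.10.003, 1408.0900, 2603.08365, doi:10.1016/j.apal.2015.10.003, Macintyre2016, Pila2022, JonesServi2011, Richardson1997, MacintyreWilkieKreiseliana1996]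

Barriers (technique_class: arithmetisation, computable-analysis, quantifier-complexity): - technique_class: arithmetisation, computable-analysis, quantifier-complexity
- Literature.Barriers.Schanuel.SchanuelPropertyNotFirstOrder: respected and orthogonal — it forbids
the Schanuel PROPERTY from being first-order over exponential fields (ultrapowers, SSC false); this
line never quantifies over models: it arithmetises the standard instance set through Kirby's
countable core, a sentence about ℕ.
- Literature.Barriers.Schanuel.AxSchanuelFunctionalNotNumerical: used only through its positive
residue (Kirby's reduction to ecl ∅, proved in tree); nothing numerical is asked of Ax–Schanuel —
the numerical content sits in Z and M, which are transcendence statements in effective dress.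
- Literature.Barriers.Schanuel.AxiomsDoNotForceSchanuel: consistent — no axiomatic/categoricity
argument is made; the calibration sharpens the moral (soft methods cannot work, and set-theoretic
independence cannot rescue them: SC is arithmetical, hence absolute).
- Literature.Barriers.Schanuel.AlgebraicIndependenceOfLogarithms: bites on the first open rung of Z
(quadratic relations among logarithms) exactly as on AlgIndepLogs — conceded; the route does not
claim Z, it names it.
- Literature.Barriers.Schanuel.LargeTranscendenceDegree: method-scope barrier for auxiliary-function
techniques; untouched (no transcendence method proposed); the bet is that calibration, not a method,
is the deliverable.
- Negatives index: empty at filing (ledger negatives --problem Schanuel: 0 refuted statements).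

Novelty grade: new-combination — RREVIEW 2026-08-15 (full text: evidence REVIEW_R1.md on stmt-Schanuel-4023). ELAB: 11/11 decls rc0; Assembly kernel-proved (attached to 4034); core nonempty and ComputableSchanuel hyp satisfiable (proved): nothing vacuous. SHAPE OBJECTION: X = ComputableSchanuel <-> Schanuel via supports 4027+4028 ( (refuter refuter-rreview-route-Schanuel-Arithmeti-73a061ab-0, 2026-08-15T13:49:20Z; prior: Kirby2010EAEF (tree: schanuelConjecture_iff_ecl_empty_holds); Richardson1997; Macintyre2016 doi:10.1016/j.apal.2015.10.003 (not held, acq-00511); JonesServi2011 §4; route-Schanuel-EclCore (closed 2026-08-15))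

History (route lifecycle, newest last):
- 2026-08-16T04:16:54Z · AUTO-CRUX (backfill): ComputableSchanuel — hypotheses of the deciding theorem that nothing in the route derives are cruxes (operator:999:1085951)
- 2026-08-23T00:34:59Z · DORMANT — reconciler: no traction for 5.8 d (last activity item-evidence-added at 2026-08-17T04:58:47Z); parked, not closed — `ledger route dormant route-Schanuel-Arithme (operator:999:2550525)

sub-problem: Schanuel · status: dormant · opened planner-plancard-Schanuel-Schanuel-schanuel-a-fde1a8fc-0 2026-08-15T11:27:05Z · rev 1 · ledger route-Schanuel-ArithmeticalComplexity
GENERATED by the gate from the ledger (D-0016/17). Provers cite these decls: `theorem foo : Summit.Schanuel.Schanuel.Theses.ArithmeticalComplexity.<Decl> := …` in Summits/Schanuel/Schanuel/Theorems/<Name>.lean.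
-/

namespace Summit.Schanuel.Schanuel.Theses.ArithmeticalComplexity

open scoped BigOperators Topology Manifold Classical MeasureTheory ProbabilityTheory Matrix InnerProductSpace ComplexConjugate ContinuousMap
open Filter Set Function TopologicalSpace MeasureTheory

attribute [summit_statement] _root_.Schanuel

open Literature.Periods

/-- item stmt-Schanuel-4023 · crux (kind.auto-crux: conjecture-grade) · rank 0 · open · by planner
why it might fail: It is Schanuel itself (⟺ via CoreComputable + KirbyCoreReduction): z = (1, πi) is computable, so it already contains algebraic independence of e and π; false iff some ℚ-independent tuple of exponential-algebraic numbers has td(z, e^z) < n.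
sources: Kirby2010EAEF, Macintyre2016, Waldschmidt2000, Turing1936
[target] Schanuel's conjecture for tuples of computable complex numbers (each coordinate has a
computable ℚ × ℚ fast Cauchy name); X of the thesis. -/
@[route_item "route-Schanuel-ArithmeticalComplexity", crux]
def ComputableSchanuel : Prop :=
  ∀ (n : ℕ) (z : Fin n → ℂ), (∀ j, ∃ g : ℕ → ℚ × ℚ, Computable g ∧ ∀ m : ℕ, ‖z j - (((g m).1 : ℂ) + ((g m).2 : ℂ) * Complex.I)‖ ≤ 1 / 2 ^ m) → LinearIndependent ℚ z → (n : Cardinal) ≤ Algebra.trdeg ℚ ↥(IntermediateField.adjoin ℚ (Set.range z ∪ Set.range (Complex.exp ∘ z)))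

/-- item stmt-Schanuel-4024 · crux · rank 2 · open · by planner
why it might fail: Mathematically safe (JonesServi2011 §4: the real case via MW96 Thm 4.1); the risk is formal: surjectivity needs EVERY non-degenerate complex zero isolated by a certified rational ball (quantitative inverse function theorem / Krawczyk) plus dovetailing over a merely r.e. set of solvable systems.
sources: JonesServi2011, MacintyreWilkieKreiseliana1996, Richardson1997, Kirby2010EAEF, Weihrauch2000
[crux] the core E (inlined ecl ∅: coordinates of non-degenerate zeros of square systems F(v, e^v) =
0, F over ℤ) is the range of a UNIFORMLY computable sequence a : ℕ → ℂ (one computable f : ℕ × ℕ → ℚ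
× ℚ with ‖a k − f(k,m)‖ ≤ 2⁻ᵐ). Card P1/DEF; the unproved fact every interpretation below rests on,
hence ranked first. [difficulty: L] -/
@[route_item "route-Schanuel-ArithmeticalComplexity"]
def EffectiveCore : Prop :=
  ∃ a : ℕ → ℂ, Set.range a = {x : ℂ | ∃ (n : ℕ) (v : Fin n → ℂ) (F : Fin n → MvPolynomial (Fin n ⊕ Fin n) ℤ), (∃ j, v j = x) ∧ (∀ i, MvPolynomial.aeval (Sum.elim v (Complex.exp ∘ v)) (F i) = 0) ∧ (Matrix.of fun i j => MvPolynomial.aeval (Sum.elim v (Complex.exp ∘ v)) (MvPolynomial.pderiv (Sum.inl j) (F i) + MvPolynomial.X (Sum.inr j) * MvPolynomial.pderiv (Sum.inr j) (F i))).det ≠ 0} ∧ ∃ f : ℕ × ℕ → ℚ × ℚ, Computable f ∧ ∀ k m : ℕ, ‖a k - (((f (k, m)).1 : ℂ) + ((f (k, m)).2 : ℂ) * Complex.I)‖ ≤ 1 / 2 ^ m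

/-- item stmt-Schanuel-4025 · crux · rank 3 · open · by planner
why it might fail: Unconditionally open since Richardson: every known procedure (Richardson1997, MW96/WSC, Macintyre2016) terminates only under SC; undecidability of the constant problem is not excluded — and since SC ⇒ Z, a refutation ¬Z would refute Schanuel outright.
sources: Richardson1997, Macintyre2016, MacintyreWilkieKreiseliana1996, WilkieNATO1997, arXiv:2603.08365
[crux] (Z, the Π⁰₂ key) some uniformly computable enumeration a of the core admits a DECISION
procedure for exponential-polynomial relations: for index lists l and list-coded P ∈ ℤ[X, Y],
whether P(a(l), e^{a(l)}) = 0. Richardson's zero-recognition problem for exponential-algebraic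
constants; known to terminate under SC, open unconditionally. [deps: EffectiveCore] [difficulty:
open-problem] -/
@[route_item "route-Schanuel-ArithmeticalComplexity"]
def DecidableCoreRelations : Prop :=
  ∃ a : ℕ → ℂ, Set.range a = {x : ℂ | ∃ (n : ℕ) (v : Fin n → ℂ) (F : Fin n → MvPolynomial (Fin n ⊕ Fin n) ℤ), (∃ j, v j = x) ∧ (∀ i, MvPolynomial.aeval (Sum.elim v (Complex.exp ∘ v)) (F i) = 0) ∧ (Matrix.of fun i j => MvPolynomial.aeval (Sum.elim v (Complex.exp ∘ v)) (MvPolynomial.pderiv (Sum.inl j) (F i) + MvPolynomial.X (Sum.inr j) * MvPolynomial.pderiv (Sum.inr j) (F i))).det ≠ 0} ∧ (∃ f : ℕ × ℕ → ℚ × ℚ, Computable f ∧ ∀ k m : ℕ, ‖a k - (((f (k, m)).1 : ℂ) + ((f (k, m)).2 : ℂ) * Complex.I)‖ ≤ 1 / 2 ^ m) ∧ ComputablePred fun p : List ℕ × List ((List ℕ × List ℕ) × ℤ) => (p.2.map fun m => (m.2 : ℂ) * (List.zipWith (fun k e => a k ^ e) p.1 m.1.1).prod * (List.zipWith (fun k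 e => Complex.exp (a k) ^ e) p.1 m.1.2).prod).sum = 0

/-- item stmt-Schanuel-4026 · crux · rank 4 · open · by planner
why it might fail: Open beyond depth 1: no height bound for ℤ-relations among coordinates of general Khovanskii points in terms of the defining data is known; nested exponentials might make relation heights outgrow every computable function (for SOME presentations halting-time padding does, hence the ∃-form).
sources: Masser1988LinearRelations, BakerWustholz1993, Macintyre2016, Kirby2010EAEF
[crux] (M, the Π⁰₁ key) some uniformly computable enumeration a of the core carries a COMPUTABLE
height bound H(l) for ℤ-linear relations: a ℚ-dependent sub-tuple a(l) has a non-zero relation with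
coefficients ≤ H(l). With Z for the same a, ℚ-linear independence on E becomes decidable and
counterexamples to SC become r.e. (CounterexamplesRE). Depth-1 rung (logs of algebraic numbers) =
Masser / Baker–Wüstholz. [deps: EffectiveCore] [difficulty: open-problem] -/
@[route_item "route-Schanuel-ArithmeticalComplexity"]
def LinearRelationBound : Prop :=
  ∃ a : ℕ → ℂ, Set.range a = {x : ℂ | ∃ (n : ℕ) (v : Fin n → ℂ) (F : Fin n → MvPolynomial (Fin n ⊕ Fin n) ℤ), (∃ j, v j = x) ∧ (∀ i, MvPolynomial.aeval (Sum.elim v (Complex.exp ∘ v)) (F i) = 0) ∧ (Matrix.of fun i j => MvPolynomial.aeval (Sum.elim v (Complex.exp ∘ v)) (MvPolynomial.pderiv (Sum.inl j) (F i) + MvPolynomial.X (Sum.inr j) * MvPolynomial.pderiv (Sum.inr j) (F i))).det ≠ 0} ∧ (∃ f : ℕ × ℕ → ℚ × ℚ, Computable f ∧ ∀ k m : ℕ, ‖a k - (((f (k, m)).1 : ℂ) + ((f (k, m)).2 : ℂ) * Complex.I)‖ ≤ 1 / 2 ^ m) ∧ ∃ H : List ℕ → ℕ, Computable H ∧ ∀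 l : List ℕ, ¬ LinearIndependent ℚ (a ∘ l.get) → ∃ c : Fin l.length → ℤ, c ≠ 0 ∧ (∀ j, (c j).natAbs ≤ H l) ∧ ∑ j, (c j : ℂ) * a (l.get j) = 0

/-- item stmt-Schanuel-4027 · support · rank 9 · open · by planner
sources: Weihrauch2000, Richardson1997, JonesServi2011
[support] every point of the core E is a computable complex number (pointwise; isolated
non-degenerate zero of an analytic map with integer data ⇒ computable by certified search in a
hard-coded isolating box). With KirbyCoreReduction it gives X ⟺ Schanuel. [difficulty: M] -/
@[route_item "route-Schanuel-ArithmeticalComplexity", crux]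
def CoreComputable : Prop :=
  ∀ x : ℂ, (∃ (n : ℕ) (v : Fin n → ℂ) (F : Fin n → MvPolynomial (Fin n ⊕ Fin n) ℤ), (∃ j, v j = x) ∧ (∀ i, MvPolynomial.aeval (Sum.elim v (Complex.exp ∘ v)) (F i) = 0) ∧ (Matrix.of fun i j => MvPolynomial.aeval (Sum.elim v (Complex.exp ∘ v)) (MvPolynomial.pderiv (Sum.inl j) (F i) + MvPolynomial.X (Sum.inr j) * MvPolynomial.pderiv (Sum.inr j) (F i))).det ≠ 0) → ∃ g : ℕ → ℚ × ℚ, Computable g ∧ ∀ m : ℕ, ‖x - (((g m).1 : ℂ) + ((g m).2 : ℂ) * Complex.I)‖ ≤ 1 / 2 ^ m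

/-- item stmt-Schanuel-4028 · support · rank 9 · open · by planner
sources: Kirby2010EAEF, Kirby2013FPEF
[support] Schanuel ⟺ Schanuel for tuples from the inlined core. Bookkeeping over the tree theorem
`Literature.NumberTheory.Transcendental.schanuelConjecture_iff_ecl_empty_holds` plus the
identification InCore = `ecl ∅` for ℂ (ℤ-polynomials via `aeval` vs coefficients in `Subring.closure
∅`; `expPDeriv` matches verbatim). Prove it LAST: its proof imports KirbyWeakSchanuelAx and widens
the route cone. [difficulty: provable-now] -/
@[route_item "route-Schanuel-ArithmeticalComplexity", crux]
def KirbyCoreReduction : Prop :=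
  Schanuel ↔ ∀ (n : ℕ) (z : Fin n → ℂ), (∀ k, ∃ (n : ℕ) (v : Fin n → ℂ) (F : Fin n → MvPolynomial (Fin n ⊕ Fin n) ℤ), (∃ j, v j = z k) ∧ (∀ i, MvPolynomial.aeval (Sum.elim v (Complex.exp ∘ v)) (F i) = 0) ∧ (Matrix.of fun i j => MvPolynomial.aeval (Sum.elim v (Complex.exp ∘ v)) (MvPolynomial.pderiv (Sum.inl j) (F i) + MvPolynomial.X (Sum.inr j) * MvPolynomial.pderiv (Sum.inr j) (F i))).det ≠ 0) → LinearIndependent ℚ z → (n : Cardinal) ≤ Algebra.trdeg ℚ ↥(IntermediateField.adjoin ℚ (Set.range z ∪ Set.range (Complex.exp ∘ z)))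

/-- item stmt-Schanuel-4029 · support · rank 9 · open · by planner
sources: Weihrauch2000, Turing1936
[support] along any uniformly computable sequence a : ℕ → ℂ, ℚ-linear independence of the finite
sub-tuples a(l) is Π⁰₂ uniformly in l (∀ relation ∃ precision witnessing apartness; effective
apartness as in the tree's KZ-periods barrier file). [difficulty: M] -/
@[route_item "route-Schanuel-ArithmeticalComplexity"]
def LinIndepPi02 : Prop :=
  ∀ a : ℕ → ℂ, (∃ f : ℕ × ℕ → ℚ × ℚ, Computable f ∧ ∀ k m : ℕ, ‖a k - (((f (k, m)).1 : ℂ) + ((f (k, m)).2 : ℂ) * Complex.I)‖ ≤ 1 / 2 ^ m) → ∃ R : List ℕ × ℕ × ℕ → Bool, Computable R ∧ ∀ l : List ℕ, LinearIndependent ℚ (a ∘ l.get) ↔ ∀ p : ℕ, ∃ q : ℕ, R (l, p, q) = true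

/-- item stmt-Schanuel-4030 · support · rank 9 · open · by planner
sources: Shoenfield1967, Weihrauch2000, Kirby2010EAEF
[support] (headline, unconditional) along any uniformly computable sequence the Schanuel instances
form a Π⁰₃ family uniformly: LinIndep is Π⁰₂, "td(a(l), e^{a(l)}) ≤ k" is Σ⁰₂ (∀ n-subsets ∃ integer
polynomial vanishing to every precision), so LinIndep → td ≥ n is Σ⁰₂ ∨ Π⁰₂ ⊆ Π⁰₃. With
EffectiveCore + KirbyCoreReduction this is "SC is a Π⁰₃ sentence". [difficulty: M] -/
@[route_item "route-Schanuel-ArithmeticalComplexity"]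
def SchanuelPi03 : Prop :=
  ∀ a : ℕ → ℂ, (∃ f : ℕ × ℕ → ℚ × ℚ, Computable f ∧ ∀ k m : ℕ, ‖a k - (((f (k, m)).1 : ℂ) + ((f (k, m)).2 : ℂ) * Complex.I)‖ ≤ 1 / 2 ^ m) → ∃ R : List ℕ × ℕ × ℕ × ℕ → Bool, Computable R ∧ ∀ l : List ℕ, (LinearIndependent ℚ (a ∘ l.get) → (l.length : Cardinal) ≤ Algebra.trdeg ℚ ↥(IntermediateField.adjoin ℚ (Set.range (a ∘ l.get) ∪ Set.range (Complex.exp ∘ a ∘ l.get)))) ↔ ∀ p : ℕ, ∃ q : ℕ, ∀ r : ℕ, R (l, p, q, r) = true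

/-- item stmt-Schanuel-4031 · support · rank 9 · open · by planner
sources: Richardson1997, Shoenfield1967
[support] (Π⁰₂ descent) if exponential-polynomial relations along a are decidable then LinIndep is
Π⁰₁, "td < n" is Σ⁰₁, and the instance family is ∀ over an r.e. matrix (Δ⁰₂ ⊆ Π⁰₂), uniformly.
[difficulty: M] -/
@[route_item "route-Schanuel-ArithmeticalComplexity"]
def SchanuelPi02OfZeroTest : Prop :=
  ∀ a : ℕ → ℂ, (∃ f : ℕ × ℕ → ℚ × ℚ, Computable f ∧ ∀ k m : ℕ, ‖a k - (((f (k, m)).1 : ℂ) + ((f (k, m)).2 : ℂ) * Complex.I)‖ ≤ 1 / 2 ^ m) → (ComputablePred fun p : List ℕ × List ((List ℕ × List ℕ) × ℤ) => (p.2.map fun m => (m.2 : ℂ) * (List.zipWith (fun k e => a k ^ e) p.1 m.1.1).prod * (List.zipWith (fun k e => Complex.exp (a k) ^ e) p.1 m.1.2).prod).sum = 0) → ∃ S : List ℕ × ℕ → Prop, REPred S ∧ ∀ l : List ℕ, (LinearIndependent ℚ (a ∘ l.get) → (l.length : Cardinal) ≤ Algebra.trdeg ℚ ↥(IntermediateField.adjoin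 ℚ (Set.range (a ∘ l.get) ∪ Set.range (Complex.exp ∘ a ∘ l.get)))) ↔ ∀ p : ℕ, S (l, p)

/-- item stmt-Schanuel-4032 · support · rank 9 · open · by planner
sources: Masser1988LinearRelations, Richardson1997, Shoenfield1967
[support] (Π⁰₁ descent) if along a relations are decidable (Z) and ℤ-linear relations computably
bounded (M) then linear independence is decidable, "td < n" is r.e., and the set of counterexample
tuples is RECURSIVELY ENUMERABLE: Schanuel along a is Π⁰₁ — refutable, if false, by one finite
computation — and the negative-side search NotSchanuel has a complete specification. [difficulty: M] -/
@[route_item "route-Schanuel-ArithmeticalComplexity"]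
def CounterexamplesRE : Prop :=
  ∀ a : ℕ → ℂ, (∃ f : ℕ × ℕ → ℚ × ℚ, Computable f ∧ ∀ k m : ℕ, ‖a k - (((f (k, m)).1 : ℂ) + ((f (k, m)).2 : ℂ) * Complex.I)‖ ≤ 1 / 2 ^ m) → (ComputablePred fun p : List ℕ × List ((List ℕ × List ℕ) × ℤ) => (p.2.map fun m => (m.2 : ℂ) * (List.zipWith (fun k e => a k ^ e) p.1 m.1.1).prod * (List.zipWith (fun k e => Complex.exp (a k) ^ e) p.1 m.1.2).prod).sum = 0) → (∃ H : List ℕ → ℕ, Computable H ∧ ∀ l : List ℕ, ¬ LinearIndependent ℚ (a ∘ l.get) → ∃ c : Fin l.length → ℤ, c ≠ 0 ∧ (∀ j, (c j).natAbs ≤ H l) ∧ ∑ j, (c j : ℂ) * a (l.get j) = 0) → REPred fun l : List ℕ => ¬ (LinearIndependent ℚ (a ∘ l.get) → (l.length : Cardinal) ≤ Algebra.trdeg ℚ ↥(IntermediateField.adjoin ℚ (Set.range (a ∘ l.get) ∪ Set.range (Complex.exp ∘ a ∘ l.get))))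

/-- item stmt-Schanuel-4033 · support · rank 9 · open · by planner
sources: Kirby2010EAEF, Richardson1997
[support] negative side, now SPECIFIED: a counterexample is a ℚ-independent tuple of the r.e. core
with td < n; enumerate certified Khovanskii codes by complexity (EffectiveCore), flag suspects by
PSLQ, and note that a CERTIFICATE of a relation needs Z (exact vanishing is never numerically
certifiable) — under Z + M the search is complete (CounterexamplesRE). Expected: evidence "no
counterexample below complexity C", not a proof. [difficulty: open-problem] -/
@[route_item "route-Schanuel-ArithmeticalComplexity"]
def NotSchanuel : Prop :=
  ¬ Schanuel

/-- item stmt-Schanuel-4034 · assembly · rank 1 · open · by planner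
sources: Kirby2010EAEF, Turing1936
[assembly] CoreComputable → KirbyCoreReduction → ComputableSchanuel → Schanuel. -/
@[route_item "route-Schanuel-ArithmeticalComplexity"]
def Assembly : Prop :=
  CoreComputable → KirbyCoreReduction → ComputableSchanuel → Schanuel

/-! D-0027 §2.1 — DECIDING THEOREM (planner-authored via `route open/edit --closes-file`; by planner-rbadge-Schanuel-ArithmeticalComplexity-7e45156c-g2-0 2026-08-15T16:14:11Z):
its hypotheses are this route's items and its conclusion the sub-problem Statement (glue_lint), and it elaborates with this file. -/

/-- D-0027 §2.1 deciding theorem of route ArithmeticalComplexity. Hypotheses = three of the route's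
own items: the support `CoreComputable` (every point of Kirby's inlined countable core E is a
computable complex number), the support `KirbyCoreReduction` (Schanuel ⟺ Schanuel for tuples drawn
from E; Kirby2010EAEF Thm 1.4 / Prop 7.2, tree theorem `schanuelConjecture_iff_ecl_empty_holds` plus
the identification of the inlined core with `ecl ∅`) and the target `ComputableSchanuel` (X:
Schanuel for tuples of computable complex numbers); conclusion = the sub-problem Statement
`Schanuel`. Pure logic: reduce to core tuples (KirbyCoreReduction, ← direction), observe that every
coordinate of a core tuple is computable (CoreComputable), apply X. The calibration cruxes
EffectiveCore / DecidableCoreRelations / LinearRelationBound and the descent supports are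
deliberately NOT hypotheses: they say what kind of arithmetical sentence X is, they do not enter
the deduction of `Schanuel`. Axioms: propext, Classical.choice, Quot.sound. -/
@[closes "route-Schanuel-ArithmeticalComplexity"] theorem closes (hCore : CoreComputable) (hKirby : KirbyCoreReduction)
    (hX : ComputableSchanuel) : _root_.Schanuel :=
  hKirby.mpr fun n z hz hli => hX n z (fun j => hCore (z j) (hz j)) hli

end Summit.Schanuel.Schanuel.Theses.ArithmeticalComplexity
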